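import Literature.Analysis.FluidPDE.TwoHalfScalarSection
import Literature.Analysis.FluidPDE.TwoHalfSpectralSplit
import Literature.Analysis.FluidPDE.NSUniqueness2DParts
import HarnessLib

/-!
# Planar and vertical sections of an `x₃`-invariant Leray–Hopf solution on `T³`

Analysis/FluidPDE support file (all proved). Let `u(t) = (v(t), θ(t)) ∘ π` be a Leray–Hopf weak
solution on `T³ × [0, T)` (accepted `Torus.IsLerayHopfOn`) of the Navier–Stokes system with the
steady `2½`-dimensional force `(g, h) ∘ π`, `g, h ∈ L²(T²)`, and datum `(v₀, θ₀) ∘ π`,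
`v₀, θ₀ ∈ L²(T²)` (Majda–Bertozzi 2002, §2.3.1, Prop. 2.7: `x₃`-independent three-dimensional
flows are a planar flow plus a transported–diffused third component). Then, on `T² × [0, T)`:

* `Torus.IsLerayHopfOn.planarSection_weak` … `_strong_initial` — the planar section `v` has every
  clause of a Leray–Hopf solution with force `g` and datum `v₀` EXCEPT the two energy inequalities
  (weak formulation `TwoHalfWeakSection`, `L^∞L²`, `L²` slices, spectral `L²H¹`
  `TwoHalfSpectralSplit`, weak `L²` continuity with weak limit `v₀` at `0⁺`, strong initial trace),
  packaged in `Torus.IsLerayHopfOn.planarSection`;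
* `Torus.IsLerayHopfOn.verticalSection` — the vertical section `θ` is a weak solution of the
  sourced advection–diffusion equation `∂ₜθ + v·∇θ = νΔθ + h` with datum `θ₀`
  (accepted `Torus.IsWeakScalarTransportForcedOn`, `TwoHalfScalarSection`), with `L²` slices and
  spectral `L²H¹` regularity.

The energy inequalities of `v` alone do NOT follow from those of `u` by projection (they couple
`v` and `θ`); in two dimensions they follow from the energy equality of weak solutions in the
energy class (Lions–Prodi), which is not part of this file. The slice `t = 0` of `u` is free in
`Torus.IsLerayHopfOn` (only `‖u 0‖₂ ≤ ‖u₀‖₂` is imposed), so no statement is made about `v 0`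
beyond `v 0 ∈ L²`.

## References

* A. J. Majda, A. L. Bertozzi, *Vorticity and Incompressible Flow* (CUP 2002), §2.3.1, Prop. 2.7.
* J. Leray, Acta Math. 63 (1934), §III; G. P. Galdi (2000), Def. 2.1 (Leray–Hopf solutions).
-/

open MeasureTheory Set Filter Topology Function UnitAddTorus
open scoped ENNReal NNReal InnerProductSpace
open Literature.Analysis.FunctionSpaces Literature.Analysis.FunctionSpaces.Torus

noncomputable section

namespace Literature.Analysis.FluidPDE

namespace Torus

section Section

variable {T ν : ℝ} {g : (UnitAddTorus (Fin 2)) → (EuclideanSpace ℝ (Fin 2))} {h : (UnitAddTorus (Fin 2)) → ℝ}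
  {v₀ : (UnitAddTorus (Fin 2)) → (EuclideanSpace ℝ (Fin 2))} {θ₀ : (UnitAddTorus (Fin 2)) → ℝ}
  {v : ℝ → (UnitAddTorus (Fin 2)) → (EuclideanSpace ℝ (Fin 2))} {θ : ℝ → (UnitAddTorus (Fin 2)) → ℝ}

/-! ### The steady `2½`-dimensional force -/

/-- The steady lifted force `(g, h) ∘ π` is measurable on every slab. [folklore] -/
theorem aestronglyMeasurable_stLift_twoHalf_steady (hg : AEStronglyMeasurable g volume) (hh : AEStronglyMeasurable h volume)
    (S : Set ℝ) :
    AEStronglyMeasurable (stLift (fun _ : ℝ => twoHalf g h)) (volume.restrict (S ×ˢ (univ : Set (EuclideanSpace ℝ (Fin 3))))) :=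
  aestronglyMeasurable_stLift_of_uncurry (u := fun _ : ℝ => twoHalf g h) (aestronglyMeasurable_twoHalf hg hh).comp_snd

/-- The steady lifted force `(g, h) ∘ π` with `L²` data has finite `L²` mass on every `(0,T) × T³`. [folklore] -/
theorem lintegral_enorm_sq_twoHalf_steady_lt_top (hg : MemLp g 2 volume) (hh : MemLp h 2 volume) (T : ℝ) :
    ∫⁻ _ in Ioo (0 : ℝ) T, ∫⁻ x, ‖twoHalf g h x‖ₑ ^ 2 < ⊤ := by
  rw [setLIntegral_const]
  exact ENNReal.mul_lt_top (lintegral_enorm_sq_lt_top (memLp_twoHalf one_le_two hg hh)) measure_Ioo_lt_top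

variable (hu : IsLerayHopfOn T ν (fun _ => twoHalf g h) (twoHalf v₀ θ₀) (fun t => twoHalf (v t) (θ t)))
include hu

/-! ### Slices and bounds -/

/-- Every slice of the planar section is in `L²`. [folklore] -/
theorem IsLerayHopfOn.planarSection_memLp {t : ℝ} (ht : t ∈ Icc 0 T) : MemLp (v t) 2 volume :=
  (memLp_of_twoHalf (hu.memLp t ht)).1

/-- Every slice of the vertical section is in `L²`. [folklore] -/
theorem IsLerayHopfOn.verticalSection_memLp {t : ℝ} (ht : t ∈ Icc 0 T) : MemLp (θ t) 2 volume :=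
  (memLp_of_twoHalf (hu.memLp t ht)).2

/-- The planar section is in `L^∞(0,T; L²)`. [folklore] -/
theorem IsLerayHopfOn.planarSection_energy_bound :
    ∃ C : ℝ≥0, ∀ᵐ t ∂(volume.restrict (Ioo 0 T)), ∫⁻ y, ‖v t y‖ₑ ^ 2 ≤ C := by
  obtain ⟨C, hC⟩ := hu.energy_bound
  exact ⟨C, hC.mono fun t ht => (lintegral_enorm_sq_left_le_twoHalf (v t) (θ t)).trans ht⟩

/-- The vertical section is in `L^∞(0,T; L²)`. [folklore] -/
theorem IsLerayHopfOn.verticalSection_energy_bound :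
    ∃ C : ℝ≥0, ∀ᵐ t ∂(volume.restrict (Ioo 0 T)), ∫⁻ y, ‖θ t y‖ₑ ^ 2 ≤ C := by
  obtain ⟨C, hC⟩ := hu.energy_bound
  exact ⟨C, hC.mono fun t ht => (lintegral_enorm_sq_right_le_twoHalf (v t) (θ t)).trans ht⟩

/-- The sections are in `L²(0,T; H¹)` (spectrally). [folklore] -/
theorem IsLerayHopfOn.sections_memL2Sobolev :
    MemL2Sobolev 0 T 1 (fun t => EuclideanSpace.complexify ∘ v t) ∧ MemL2Sobolev 0 T 1 (fun t y => (θ t y : ℂ)) := by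
  refine memL2Sobolev_of_twoHalf ?_ hu.memL2Sobolev
  filter_upwards [ae_restrict_mem measurableSet_Ioo] with t ht
  exact ⟨(hu.planarSection_memLp (Ioo_subset_Icc_self ht)).integrable one_le_two,
    (hu.verticalSection_memLp (Ioo_subset_Icc_self ht)).integrable one_le_two⟩

/-! ### The weak formulations -/

/-- **The planar section is a forced weak Navier–Stokes solution on `T²`** with force `g` and
datum `v₀` (for `v₀ ∈ L²` and integrable `g`). [folklore] -/
theorem IsLerayHopfOn.planarSection_weak (hv₀ : MemLp v₀ 2 volume) (hg : Integrable g volume) :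
    IsWeakNSSolutionForcedOn T ν (fun _ => g) v₀ v :=
  isWeakNSSolutionForcedOn_of_twoHalf hu.weak (fun _ ht => hu.planarSection_memLp (Ioo_subset_Icc_self ht)) hv₀
    fun _ _ => hg

/-- **The vertical section is a weak sourced passive scalar on `T²`** driven by the planar
section, with source `h` and datum `θ₀` (`ν ≥ 0`, `g, h, θ₀ ∈ L²`; the `L^∞L²` bound at every
`t ∈ (0, T)` comes from the energy inequality of `u`). [folklore] -/
theorem IsLerayHopfOn.verticalSection (hν : 0 ≤ ν) (hg : MemLp g 2 volume) (hh : MemLp h 2 volume)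
    (hθ₀ : MemLp θ₀ 2 volume) : IsWeakScalarTransportForcedOn T ν v (fun _ => h) θ₀ θ := by
  obtain ⟨M, hM, hbound⟩ := hu.exists_forall_lintegral_enorm_sq_le hν
    (aestronglyMeasurable_stLift_twoHalf_steady hg.1 hh.1 _) (lintegral_enorm_sq_twoHalf_steady_lt_top hg hh T)
  refine isWeakScalarTransportForcedOn_of_twoHalf hu.weak (fun t ht => hu.memLp t (Ioo_subset_Icc_self ht))
    (C := M.toNNReal) (fun t ht => ?_) hθ₀ hh.1.comp_snd ?_
  · rw [ENNReal.coe_toNNReal hM]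
    exact hbound t (Ioo_subset_Icc_self ht)
  · show ∫⁻ _ in Ioo (0 : ℝ) T, ∫⁻ y, ‖h y‖ₑ < ⊤
    rw [setLIntegral_const]
    exact ENNReal.mul_lt_top (hh.integrable one_le_two).2 measure_Ioo_lt_top

/-! ### Continuity clauses of the planar section -/

/-- **Weak `L²` continuity of the planar section** on `(0, T]`, with weak limit `v₀` at `0⁺`
(pair `u` with the purely planar lift `(w, 0) ∘ π`). [folklore] -/
theorem IsLerayHopfOn.planarSection_weak_continuous (hT : 0 < T) (hv₀ : MemLp v₀ 2 volume)
    (w : (UnitAddTorus (Fin 2)) → (EuclideanSpace ℝ (Fin 2))) (hw : MemLp w 2 volume) :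
    ContinuousOn (fun t => ∫ y, ⟪v t y, w y⟫_ℝ) (Ioc 0 T) ∧
      Tendsto (fun t => ∫ y, ⟪v t y, w y⟫_ℝ) (𝓝[>] 0) (𝓝 (∫ y, ⟪v₀ y, w y⟫_ℝ)) := by
  obtain ⟨hc, hlim⟩ := hu.weak_continuous (twoHalf w 0) (memLp_twoHalf one_le_two hw MemLp.zero)
  have heq : ∀ t ∈ Icc 0 T, (∫ x, ⟪twoHalf (v t) (θ t) x, twoHalf w 0 x⟫_ℝ) = ∫ y, ⟪v t y, w y⟫_ℝ :=
    fun t ht => integral_inner_twoHalf_planar (hu.planarSection_memLp ht) hw (θ t)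
  refine ⟨hc.congr fun t ht => (heq t (Ioc_subset_Icc_self ht)).symm, ?_⟩
  rw [integral_inner_twoHalf_planar hv₀ hw θ₀] at hlim
  refine hlim.congr' ?_
  filter_upwards [Ioo_mem_nhdsGT hT] with t ht
  exact heq t (Ioo_subset_Icc_self ht)

/-- **Strong initial trace of the planar section**: `‖v(t) - v₀‖₂ → 0` as `t → 0⁺`
(`‖v(t) - v₀‖₂ ≤ ‖u(t) - u₀‖₂`). [folklore] -/
theorem IsLerayHopfOn.planarSection_strong_initial (hT : 0 < T) (hv₀ : MemLp v₀ 2 volume) :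
    Tendsto (fun t => eLpNorm (v t - v₀) 2 volume) (𝓝[>] 0) (𝓝 0) := by
  refine tendsto_of_tendsto_of_tendsto_of_le_of_le' tendsto_const_nhds hu.strong_initial
    (Eventually.of_forall fun _ => zero_le) ?_
  filter_upwards [Ioo_mem_nhdsGT hT] with t ht
  have hm : AEStronglyMeasurable (v t - v₀) volume := ((hu.planarSection_memLp (Ioo_subset_Icc_self ht)).sub hv₀).1
  have h := eLpNorm_left_le_twoHalf hm (θ t - θ₀) 2
  rwa [twoHalf_sub] at h

/-- **Strong initial trace of the vertical section**: `‖θ(t) - θ₀‖₂ → 0` as `t → 0⁺`. [folklore] -/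
theorem IsLerayHopfOn.verticalSection_strong_initial (hT : 0 < T) (hθ₀ : MemLp θ₀ 2 volume) :
    Tendsto (fun t => eLpNorm (θ t - θ₀) 2 volume) (𝓝[>] 0) (𝓝 0) := by
  refine tendsto_of_tendsto_of_tendsto_of_le_of_le' tendsto_const_nhds hu.strong_initial
    (Eventually.of_forall fun _ => zero_le) ?_
  filter_upwards [Ioo_mem_nhdsGT hT] with t ht
  have hm : AEStronglyMeasurable (θ t - θ₀) volume := ((hu.verticalSection_memLp (Ioo_subset_Icc_self ht)).sub hθ₀).1
  have h := eLpNorm_right_le_twoHalf (v t - v₀) hm 2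
  rwa [twoHalf_sub] at h

/-! ### The package -/

/-- **The planar section of an `x₃`-invariant Leray–Hopf solution is a pre-Leray–Hopf planar
flow**: every clause of `Torus.IsLerayHopfOn T ν (fun _ => g) v₀ v` except the two energy
inequalities (Majda–Bertozzi 2002, §2.3.1, Prop. 2.7, in the weak setting). [folklore] -/
theorem IsLerayHopfOn.planarSection (hT : 0 < T) (hg : MemLp g 2 volume) (hv₀ : MemLp v₀ 2 volume) :
    IsWeakNSSolutionForcedOn T ν (fun _ => g) v₀ v ∧
      (∃ C : ℝ≥0, ∀ᵐ t ∂(volume.restrict (Ioo 0 T)), ∫⁻ y, ‖v t y‖ₑ ^ 2 ≤ C) ∧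
      (∀ t ∈ Icc 0 T, MemLp (v t) 2 volume) ∧
      MemL2Sobolev 0 T 1 (fun t => EuclideanSpace.complexify ∘ v t) ∧
      (∀ w : (UnitAddTorus (Fin 2)) → (EuclideanSpace ℝ (Fin 2)), MemLp w 2 volume →
        ContinuousOn (fun t => ∫ y, ⟪v t y, w y⟫_ℝ) (Ioc 0 T) ∧
          Tendsto (fun t => ∫ y, ⟪v t y, w y⟫_ℝ) (𝓝[>] 0) (𝓝 (∫ y, ⟪v₀ y, w y⟫_ℝ))) ∧
      Tendsto (fun t => eLpNorm (v t - v₀) 2 volume) (𝓝[>] 0) (𝓝 0) :=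
  ⟨hu.planarSection_weak hv₀ (hg.integrable one_le_two), hu.planarSection_energy_bound,
    fun _ ht => hu.planarSection_memLp ht, hu.sections_memL2Sobolev.1,
    fun w hw => hu.planarSection_weak_continuous hT hv₀ w hw, hu.planarSection_strong_initial hT hv₀⟩

end Section

end Torus

end Literature.Analysis.FluidPDE

end
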